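import Mathlib
import Summits.Ventures.PercRepro2.Defs
import Summits.Ventures.PercRepro2.Independence
import Summits.Ventures.PercRepro2.Harris
import Summits.Ventures.PercRepro2.Graph
import Summits.Ventures.PercRepro2.Exploration
import Summits.Ventures.PercRepro2.Events
import Summits.Ventures.PercRepro2.FourFunctions
import Summits.Ventures.PercRepro2.Induced
import Summits.Ventures.PercRepro2.Frontier
import Summits.Ventures.PercRepro2.ObsIndependence
import Summits.Ventures.PercRepro2.BHK
import Summits.Ventures.PercRepro2.BHKEvents
import Summits.Ventures.PercRepro2.MultiSource
import Summits.Ventures.PercRepro2.OrderPreservation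
import Summits.Ventures.PercRepro2.SeedSet
import Summits.Ventures.PercRepro2.MultiSourceFun
import Summits.Ventures.PercRepro2.CrossRootT
import Summits.Ventures.PercRepro2.VdBKahn
import Summits.Ventures.PercRepro2.LemmaA
import Summits.Ventures.PercRepro2.GateDefs
import Summits.Ventures.PercRepro2.GateFrame
import Summits.Ventures.PercRepro2.GateSFrame

/-!
# The gates that are Lemma A and Lemma A′ (blind cell PercRepro2, typer-1; mine-c g6 MINE-C.md
§13.2 "LA = Lemma A (s avoids T ∪ W), LA′ = Lemma A in the T-frame (hull(T) avoids {s} ∪ W;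
THEOREM)" and §13.4 "Φ(E) ≥ 0 on the two avoidance families A_W = R_{T∪W}, B_W = {hull avoids
{s} ∪ W}")

Three families of gates `GateRow s T a b A B` are theorems for trivial or classical reasons:

* `B = ∅` or `A = ∅`: the gate is `R_T` itself and the row is BHK 1.3 (`GateRow_empty_left/right`,
  `MineCLemmas.avoidMore_nonneg` at `U = ∅`);
* **`GateRow_of_T_mem`** (`B ∩ T ≠ ∅`, e.g. `W ∩ T ≠ ∅` for `A = B = W`): `K` hits `B` surely, the gate
  is `R_{T ∪ A} = {S avoids T ∪ A}` and the row is **Lemma A** (`avoidMore_nonneg`);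
* **`GateRow_of_root_mem`** (`s ∈ A`, e.g. `s ∈ W`): `S` hits `A` surely, the gate is
  `R_T ∩ {K avoids B}` and the row is **Lemma A′** (the hull frame): with `r′, x′, y′, xy′` the masses
  on `R′ = R_T ∩ {K avoids B}`, `Φ · r′ = r² (xy′ r′ − x′ y′) + (r x′ − r′ x)(r y′ − r′ y)`
  (`lemma_Aprime_identity`), the first term by the hull-frame positive association
  (`GateFrame.hull_frame_pa`) and the two shifts `r x′ ≥ r′ x`, `r y′ ≥ r′ y` by
  `GateFrame.hits_Y_le` (the marker events are negatively correlated with `{K hits B}` given `R_T`).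

Together with the marker gates these are exactly mine-c's six theorems "Lemma A, A(u), A(w),
Lemma A′, A′(u), A′(w)" of the nine-class census, plus the dual/marker gates.
-/

namespace Summit.Ventures.PercRepro2

namespace Gate

open scoped Classical

variable {V : Type*} {E : Type*} [Fintype E] [DecidableEq E] [Fintype V] [DecidableEq V]
  {R : Type*} [Field R] [LinearOrder R] [IsStrictOrderedRing R]

variable (p : E → R) (ends : E → Sym2 V) (s : V) (T : Finset V) (a b : V) (A B : Finset V)

/-- The row on the gate `R_T` itself is BHK 1.3 (Lemma A with `U = ∅`), in the shape of `GateRow`. -/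
lemma gateRow_of_gate_eq_avoid (hp : IsProbVec p) (hG : gateEvent ends s T A B = avoidAll ends s T) :
    GateRow p ends s T a b A B := by
  unfold GateRow
  rw [hG]
  have key := MineCLemmas.avoidMore_nonneg p ends hp s {a} {b} T ∅
  rw [Finset.union_empty] at key
  linarith [key]

/-- `GateRow s T a b ∅ B`: the gate is `R_T`. -/
theorem GateRow_empty_left (hp : IsProbVec p) : GateRow p ends s T a b ∅ B :=
  gateRow_of_gate_eq_avoid p ends s T a b ∅ B hp (gateEvent_empty_left ends s T B)

/-- `GateRow s T a b A ∅`: the gate is `R_T`. -/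
theorem GateRow_empty_right (hp : IsProbVec p) : GateRow p ends s T a b A ∅ :=
  gateRow_of_gate_eq_avoid p ends s T a b A ∅ hp (gateEvent_empty_right ends s T A)

omit [Fintype E] [DecidableEq E] [Fintype V] in
/-- If `B` meets `T`, the hull hits `B` surely and the gate is `R_{T ∪ A}`. -/
lemma gateEvent_eq_of_T_mem {t : V} (ht : t ∈ T) (htB : t ∈ B) :
    gateEvent ends s T A B = avoidAll ends s (T ∪ A) := by
  rw [avoidAll_union_eq]
  ext ω
  simp only [gateEvent, Set.mem_inter_iff, Set.mem_compl_iff, not_and]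
  constructor
  · rintro ⟨hR, h⟩
    refine ⟨hR, ?_⟩
    by_contra hA
    have hS : ω ∈ hitsS ends s A := by rw [hitsS_eq_compl]; exact hA
    exact h hS ⟨t, htB, t, ht, conn_refl _ _ _⟩
  · rintro ⟨hR, hA⟩
    refine ⟨hR, fun hS _ => ?_⟩
    rw [hitsS_eq_compl] at hS
    exact hS hA

/-- **Lemma A as a gate** (`B ∩ T ≠ ∅`): `GateRow s T a b A B` — the row on `R_{T ∪ A}`. -/
theorem GateRow_of_T_mem (hp : IsProbVec p) {t : V} (ht : t ∈ T) (htB : t ∈ B) :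
    GateRow p ends s T a b A B := by
  unfold GateRow
  rw [gateEvent_eq_of_T_mem ends s T A B ht htB]
  exact MineCLemmas.avoidMore_nonneg p ends hp s {a} {b} T A

omit [Fintype E] [DecidableEq E] [Fintype V] [DecidableEq V] in
/-- If `s ∈ A`, the root cluster hits `A` surely and the gate is `R_T ∩ {K avoids B}`. -/
lemma gateEvent_eq_of_root_mem (hs : s ∈ A) :
    gateEvent ends s T A B = avoidAll ends s T ∩ (hitsK ends T B)ᶜ := by
  ext ω
  simp only [gateEvent, Set.mem_inter_iff, Set.mem_compl_iff, not_and]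
  constructor
  · rintro ⟨hR, h⟩; exact ⟨hR, h ⟨s, hs, conn_refl _ _ _⟩⟩
  · rintro ⟨hR, h⟩; exact ⟨hR, fun _ => h⟩

omit [DecidableEq V] [LinearOrder R] [IsStrictOrderedRing R] in
/-- The identity of Lemma A′: `Φ · r′ = r² (xy′ r′ − x′ y′) + (r x′ − r′ x)(r y′ − r′ y)`. -/
lemma lemma_Aprime_identity (r x y r' x' y' xy' : R) :
    (r ^ 2 * xy' - r * (x * y' + y * x') + x * y * r') * r' =
      r ^ 2 * (xy' * r' - x' * y') + (r * x' - r' * x) * (r * y' - r' * y) := by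
  ring

omit [DecidableEq V] in
/-- The complemented form of `hits_Y_le`: `P(Y; R, K avoids B) · P(R) ≥ P(Y; R) · P(R, K avoids B)`. -/
lemma avoids_Y_ge (hp : IsProbVec p) :
    prob p (connAll ends s {b} ∩ avoidAll ends s T) * prob p (avoidAll ends s T ∩ (hitsK ends T B)ᶜ) ≤
      prob p (connAll ends s {b} ∩ (avoidAll ends s T ∩ (hitsK ends T B)ᶜ)) *
        prob p (avoidAll ends s T) := by
  have h := hits_Y_le p ends s T B b hp
  have e1 : prob p (connAll ends s {b} ∩ (avoidAll ends s T ∩ (hitsK ends T B)ᶜ)) =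
      prob p (connAll ends s {b} ∩ avoidAll ends s T) -
        prob p (hitsK ends T B ∩ connAll ends s {b} ∩ avoidAll ends s T) := by
    have h2 := prob_inter_add_prob_inter_compl p (connAll ends s {b} ∩ avoidAll ends s T)
      (hitsK ends T B)
    have e3 : connAll ends s {b} ∩ avoidAll ends s T ∩ hitsK ends T B =
        hitsK ends T B ∩ connAll ends s {b} ∩ avoidAll ends s T := by
      ext ω; simp only [Set.mem_inter_iff]; tauto
    have e4 : connAll ends s {b} ∩ avoidAll ends s T ∩ (hitsK ends T B)ᶜ =
        connAll ends s {b} ∩ (avoidAll ends s T ∩ (hitsK ends T B)ᶜ) := Set.inter_assoc _ _ _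
    rw [e3, e4] at h2
    linear_combination h2
  have e2 : prob p (avoidAll ends s T ∩ (hitsK ends T B)ᶜ) =
      prob p (avoidAll ends s T) - prob p (hitsK ends T B ∩ avoidAll ends s T) := by
    have h2 := prob_inter_add_prob_inter_compl p (avoidAll ends s T) (hitsK ends T B)
    rw [Set.inter_comm (avoidAll ends s T) (hitsK ends T B)] at h2
    linear_combination h2
  rw [e1, e2]
  nlinarith [h]

/-- **Lemma A′ as a gate** (`s ∈ A`): `GateRow s T a b A B` — the row on `R_T ∩ {K avoids B}`
(the hull frame). -/
theorem GateRow_of_root_mem (hp : IsProbVec p) (hs : s ∈ A) : GateRow p ends s T a b A B := by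
  unfold GateRow
  rw [gateEvent_eq_of_root_mem ends s T A B hs]
  set r := prob p (avoidAll ends s T) with hr
  set x := prob p (connAll ends s {a} ∩ avoidAll ends s T) with hx
  set y := prob p (connAll ends s {b} ∩ avoidAll ends s T) with hy
  set r' := prob p (avoidAll ends s T ∩ (hitsK ends T B)ᶜ) with hr'
  set x' := prob p (connAll ends s {a} ∩ (avoidAll ends s T ∩ (hitsK ends T B)ᶜ)) with hx'
  set y' := prob p (connAll ends s {b} ∩ (avoidAll ends s T ∩ (hitsK ends T B)ᶜ)) with hy'
  set xy' := prob p (connAll ends s ({a} ∪ {b}) ∩ (avoidAll ends s T ∩ (hitsK ends T B)ᶜ)) with hxy'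
  have hpa := hull_frame_pa p ends s T B a b hp
  have hxs := avoids_Y_ge p ends s T a B hp
  have hys := avoids_Y_ge p ends s T b B hp
  have hr'0 : 0 ≤ r' := prob_nonneg hp _
  have hx'0 : 0 ≤ x' := prob_nonneg hp _
  have hxy'0 : 0 ≤ xy' := prob_nonneg hp _
  have hx'r : x' ≤ r' := prob_mono hp Set.inter_subset_right
  have hxy'x : xy' ≤ x' := prob_mono hp (Set.inter_subset_inter_left _ (by
    rw [connAll_pair_eq]; exact Set.inter_subset_left))
  rcases hr'0.lt_or_eq with hpos | hzero
  · have hmul : 0 ≤ (r ^ 2 * xy' - r * (x * y' + y * x') + x * y * r') * r' := by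
      rw [lemma_Aprime_identity]
      exact add_nonneg (mul_nonneg (sq_nonneg _) (by linarith [hpa]))
        (mul_nonneg (by linarith [hxs]) (by linarith [hys]))
    exact nonneg_of_mul_nonneg_left hmul hpos
  · have hx'' : x' = 0 := le_antisymm (hzero ▸ hx'r) hx'0
    have hxy'' : xy' = 0 := le_antisymm (hx'' ▸ hxy'x) hxy'0
    have hy'' : y' = 0 := le_antisymm (hzero ▸ (prob_mono hp Set.inter_subset_right))
      (prob_nonneg hp _)
    rw [hx'', hxy'', hy'', ← hzero]
    simp

end Gate

end Summit.Ventures.PercRepro2
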